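import Mathlib
import Summits.KontsevichZagierPeriods.Zeta5Search.FourthOrderReflectD
import Summits.KontsevichZagierPeriods.Zeta5Search.FourthOrderClassFrame
import HarnessLib

/-!
# ζ(5) search — REFLECTION of the class polynomial: `H_x̄ ≡ −H_x(L − ·)` coefficientwise `(mod p⁴)` (tools for THEOREM L5)

Cell `pub-zeta5` (HONEST FRAMING: systematic search; no irrationality claim unless certified), typer seat generation 13.
REPORT-gen2-g14 §2, Lemma R in frame coordinates (input of the orbit lemma, Lemma O): for a pole class `x` whose exponents dominate the
palindromic frame type `T = (L, e)` at offset `a` (`E(T) = −M`, `M` even), the conjugate class `x̄` dominates `T` at the complementary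
offset `c = L' − L − a` with the REVERSED exponents (`Dominates.reverse`), its shape polynomial is the reflected one
(`shapePoly_reflect`: `P_x(L − X) = (−1)^{deg} P_x̄(X)`), the centre factor reflects with a sign (`centreZ_comp_reflect`), and with the
cubic Lemma R (`padicNorm_reflD_coeff_le`):
**`classH_reflect`** — every coefficient of `H_x̄ + H_x(L − X)` has `p`-adic norm `≤ p⁻⁴`, where `H = classH` is the class polynomial of
`FourthOrderClassFrame`.  `p`-adic norms of rational numbers; nothing here bears on irrationality.
-/

noncomputable section

open Finset PowerSeries

namespace Summit.KontsevichZagierPeriods.Zeta5Search.SecondOrder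

open Summit.KontsevichZagierPeriods.Zeta5Search.CasoratianValuation (InPolytope)
open Summit.KontsevichZagierPeriods.Zeta5Search.ClusterValuation
open Summit.KontsevichZagierPeriods.Zeta5Search.PadicSeries
open Summit.KontsevichZagierPeriods.Zeta5Search.CellA (padicNorm_p)
open Summit.KontsevichZagierPeriods.Zeta5Search.LevelClass (typeExp level_mem classSet_level level_injective)
open Summit.KontsevichZagierPeriods.Zeta5Search.BigPrime (padicNorm_mul_le_one)
open Summit.KontsevichZagierPeriods.Zeta5Search.CellKit (conj_level netExp_conj_level)
open Summit.KontsevichZagierPeriods.Zeta5Search.SecondResidueLaw (phi3Hat cubicHat)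

variable {p : ℕ} [hp : Fact p.Prime]

/-! ## §1 Reflection of the shape polynomial -/

section ShapeReflect

variable {L a L' : ℕ} {e f : ℕ → ℤ} (hL' : a + L ≤ L') (hdom : ∀ m ≤ L', coreExt L a e m ≤ f m)
  (hpal : ∀ j ≤ L, e (L - j) = e j)
include hL' hdom hpal

omit hp hdom in
/-- The core-extension of a palindrome reflects: `ẽ_c(m) = ẽ_a(L' − m)` with `c = L' − L − a`. -/
theorem coreExt_reflect {m : ℕ} (hm : m ≤ L') : coreExt L (L' - L - a) e m = coreExt L a e (L' - m) := by
  unfold coreExt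
  by_cases hc : L' - L - a ≤ m ∧ m ≤ L' - L - a + L
  · rw [if_pos hc, if_pos ⟨by omega, by omega⟩, ← hpal (L' - m - a) (by omega)]
    congr 1; omega
  · rw [if_neg hc, if_neg (by omega)]

omit hp hdom in
/-- Raise multiplicities of the reversed shape. -/
theorem raiseMult_reflect {m : ℕ} (hm : m ≤ L') :
    raiseMult L (L' - L - a) e (fun k => f (L' - k)) m = raiseMult L a e f (L' - m) := by
  unfold raiseMult
  rw [coreExt_reflect hL' hpal hm]

omit hp hdom in
/-- **`P_x(L − X) = (−1)^{deg P} · P_x̄(X)`**: the shape polynomial of the reversed shape at the complementary offset. -/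
theorem shapePoly_reflect :
    (shapePoly L a L' e f).comp (Polynomial.C (L : ℚ) - Polynomial.X) =
      Polynomial.C ((-1 : ℚ) ^ (shapePoly L a L' e f).natDegree) * shapePoly L (L' - L - a) L' e (fun k => f (L' - k)) := by
  rw [shapePoly_natDegree]
  unfold shapePoly
  rw [Polynomial.prod_comp]
  -- reindex the reflected product by `m ↦ L' − m`
  have hre : ∏ m ∈ range (L' + 1), (Polynomial.X - Polynomial.C ((m : ℚ) - ((L' - L - a : ℕ) : ℚ))) ^
        raiseMult L (L' - L - a) e (fun k => f (L' - k)) m =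
      ∏ m ∈ range (L' + 1), (Polynomial.X - Polynomial.C ((L : ℚ) + a - m)) ^ raiseMult L a e f m := by
    rw [← prod_range_reflect (fun m => (Polynomial.X - Polynomial.C ((L : ℚ) + a - m)) ^ raiseMult L a e f m) (L' + 1)]
    refine prod_congr rfl fun m hm => ?_
    have hmL : m ≤ L' := by have := mem_range.1 hm; omega
    simp only [Nat.add_sub_cancel]
    rw [raiseMult_reflect hL' hpal hmL]
    congr 2
    have h1 : (((L' - m : ℕ) : ℚ)) = (L' : ℚ) - m := by push_cast [hmL]; ring
    have h2 : (((L' - L - a : ℕ) : ℚ)) = (L' : ℚ) - L - a := by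
      rw [Nat.sub_sub]; push_cast [show L + a ≤ L' by omega]; ring
    rw [h1, h2]; ring
  rw [hre, ← prod_pow_eq_pow_sum, map_prod, ← prod_mul_distrib]
  refine prod_congr rfl fun m _ => ?_
  rw [map_pow, ← mul_pow, Polynomial.pow_comp, Polynomial.sub_comp, Polynomial.X_comp, Polynomial.C_comp]
  congr 1
  rw [map_neg, map_one]
  have : Polynomial.C ((m : ℚ) - a) = Polynomial.C (m : ℚ) - Polynomial.C (a : ℚ) := by rw [map_sub]
  rw [this, show Polynomial.C ((L : ℚ) + a - m) = Polynomial.C (L : ℚ) + Polynomial.C (a : ℚ) - Polynomial.C (m : ℚ) by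
    rw [map_sub, map_add]]
  ring

omit hp hdom hpal in
/-- The core exponents sum to `E(T)`. -/
theorem sum_coreExt : ∑ m ∈ range (L' + 1), coreExt L a e m = typeExp L e := by
  unfold typeExp
  rw [← sum_filter_add_sum_filter_not (range (L' + 1)) (fun m => a ≤ m ∧ m ≤ a + L)]
  have h0 : ∑ m ∈ (range (L' + 1)).filter (fun m => ¬ (a ≤ m ∧ m ≤ a + L)), coreExt L a e m = 0 :=
    sum_eq_zero fun m hm => coreExt_off L a e (by have := (mem_filter.1 hm).2; omega)
  have hset : (range (L' + 1)).filter (fun m => a ≤ m ∧ m ≤ a + L) = (range (L + 1)).image (fun j => j + a) := by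
    ext m; simp only [mem_filter, mem_range, mem_image]
    constructor
    · rintro ⟨h1, h2, h3⟩; exact ⟨m - a, by omega, by omega⟩
    · rintro ⟨j, hj, rfl⟩; exact ⟨by omega, by omega, by omega⟩
  rw [h0, add_zero, hset, sum_image (fun x _ y _ h => by simpa using h)]
  exact sum_congr rfl fun j hj => coreExt_core L a e (by have := mem_range.1 hj; omega)

omit hp hpal in
/-- **`deg P = Σ_m f m − E(T)`**: the number of raises. -/
theorem shapePoly_natDegree_eq :
    ((shapePoly L a L' e f).natDegree : ℤ) = (∑ m ∈ range (L' + 1), f m) - typeExp L e := by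
  rw [shapePoly_natDegree, ← sum_coreExt hL' (e := e), Nat.cast_sum, ← sum_sub_distrib]
  refine sum_congr rfl fun m hm => ?_
  have := f_eq_coreExt_add hdom m (by have := mem_range.1 hm; omega)
  omega

end ShapeReflect

/-! ## §2 The conjugate class: levels, exponents, centre factor -/

section ConjClass

variable (b : ℕ → ℤ) (hb : InPolytope b) (hp5 : 5 ≤ p) (hpn : (p : ℤ) ≤ b 0) {x : ℕ} (hx : x < p)
include hb hp5 hpn hx

omit hb hp5 hpn in
/-- `E_x = Σ_k netExp(x + kp) + [odd centre in the class]` for a level class. -/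
theorem classExp_levelZ {L : ℕ} (hL : x + L * p ≤ (b 0).toNat) (hL' : (b 0).toNat < x + L * p + p) :
    classExp b p x = (∑ k ∈ range (L + 1), netExp b (x + k * p)) + (if ¬ (2 : ℤ) ∣ b 0 ∧ CentreIn b p x then 1 else 0) := by
  unfold classExp
  rw [classSet_level b hx hL hL', sum_image (fun a _ c _ h => level_injective hp.out.pos x h)]

omit hp hb hp5 hpn in
/-- The top level of the conjugate class. -/
theorem topLevel_conj_level {L : ℕ} (hL : x + L * p ≤ (b 0).toNat) (hL' : (b 0).toNat < x + L * p + p) :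
    topLevel b p (conjClass b p x) = L := by
  obtain ⟨-, hM, hM'⟩ := conj_level b hx hL hL'
  exact topLevel_level b hM hM'

omit hp5 hpn in
/-- The centre factor of the conjugate class is the same polynomial. -/
theorem centreZ_conj {L : ℕ} (hL : x + L * p ≤ (b 0).toNat) (hL' : (b 0).toNat < x + L * p + p) :
    centreZ b p (conjClass b p x) L = centreZ b p x L := by
  have h0 : 0 ≤ b 0 := hb.1.1
  have hq := level_mem b hx hL hL' le_rfl
  have hconj : conjClass b p x = (b 0).toNat - (x + L * p) := CellKit.conjClass_eq_level b hL hL'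
  have hc : CentreIn b p (conjClass b p x) ↔ CentreIn b p x := by
    rw [hconj, centreIn_reflect b h0 hL]; exact centreIn_iff_of_mem hq
  unfold centreZ
  by_cases h : ¬ (2 : ℤ) ∣ b 0 ∧ CentreIn b p x
  · rw [if_pos h, if_pos ⟨h.1, hc.2 h.2⟩]
  · rw [if_neg h, if_neg (fun h' => h ⟨h'.1, hc.1 h'.2⟩)]

omit hp hb hp5 hpn hx in
/-- **Reflection of the centre factor**: `Z_x(L + a − X) = ε · Z_x(X + c)` with `ε = −1` (centre) / `1`, `a + L + c = L'`. -/
theorem centreZ_comp_reflect {L' L a c : ℕ} (hsum : a + L + c = L') :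
    ((centreZ b p x L').comp (Polynomial.X + Polynomial.C (a : ℚ))).comp (Polynomial.C (L : ℚ) - Polynomial.X) =
      Polynomial.C (if ¬ (2 : ℤ) ∣ b 0 ∧ CentreIn b p x then (-1 : ℚ) else 1) *
        (centreZ b p x L').comp (Polynomial.X + Polynomial.C (c : ℚ)) := by
  unfold centreZ
  split_ifs with h
  · simp only [Polynomial.sub_comp, Polynomial.X_comp, Polynomial.C_comp, Polynomial.add_comp]
    have hc : (L' : ℚ) = a + L + c := by exact_mod_cast hsum.symm
    rw [show Polynomial.C ((L' : ℚ) / 2) = Polynomial.C (((a : ℚ) + L + c) / 2) by rw [hc]]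
    have e : ∀ u v : ℚ, Polynomial.C u + Polynomial.C v = Polynomial.C (u + v) := fun u v => (map_add _ u v).symm
    -- both sides are linear polynomials; compare via `C`-linearity
    have key : Polynomial.C (L : ℚ) - Polynomial.X + Polynomial.C (a : ℚ) - Polynomial.C (((a : ℚ) + L + c) / 2) =
        Polynomial.C (-1 : ℚ) * (Polynomial.X + Polynomial.C (c : ℚ) - Polynomial.C (((a : ℚ) + L + c) / 2)) := by
      have h1 : Polynomial.C (L : ℚ) + Polynomial.C (a : ℚ) - Polynomial.C (((a : ℚ) + L + c) / 2) =
          -(Polynomial.C (c : ℚ) - Polynomial.C (((a : ℚ) + L + c) / 2)) := by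
        rw [← map_add, ← map_sub, ← map_sub, ← map_neg]; congr 1; ring
      rw [map_neg, map_one]
      linear_combination h1
    exact key
  · simp

omit hp hp5 hpn hx in
/-- The shape polynomial of the conjugate class (exponents `k ↦ netExp(x̄ + kp) = f(L' − k)`). -/
theorem shapePoly_conj {L' L c : ℕ} (hL : x + L' * p ≤ (b 0).toNat) (hL' : (b 0).toNat < x + L' * p + p) (e : ℕ → ℤ) :
    shapePoly L c L' e (fun k => netExp b (conjClass b p x + k * p)) =
      shapePoly L c L' e (fun k => netExp b (x + (L' - k) * p)) := by
  have h0 : 0 ≤ b 0 := hb.1.1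
  unfold shapePoly
  refine prod_congr rfl fun m hm => ?_
  have hmL : m ≤ L' := by have := mem_range.1 hm; omega
  unfold raiseMult
  dsimp only
  rw [netExp_conj_level b hL hL' h0 hmL]

end ConjClass

/-! ## §3 The reflection of `H_x` -/

section Reflect

variable (b : ℕ → ℤ) (hb : InPolytope b) (hp5 : 5 ≤ p) (hpn : (p : ℤ) ≤ b 0) {x : ℕ} (hx : x < p)
  {M L a : ℕ} {e : ℕ → ℤ} (hMe : Even M) (hTM : typeExp L e = -(M : ℤ))
  (hdom : Dominates L e (topLevel b p x) (fun k => netExp b (x + k * p)) a) (hpal : ∀ j ≤ L, e (L - j) = e j)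
include hb hp5 hpn hx hMe hTM hdom hpal

omit hp5 hMe hTM in
/-- **The conjugate class dominates the frame at the complementary offset** (reversed exponents). -/
theorem dominates_conj : Dominates L e (topLevel b p (conjClass b p x)) (fun k => netExp b (conjClass b p x + k * p))
    (topLevel b p x - L - a) := by
  have h0 : 0 ≤ b 0 := hb.1.1
  have hxn : x ≤ (b 0).toNat := le_b0_of_lt b hpn hx
  obtain ⟨hL, hL'⟩ := level_bounds' (p := p) b hxn
  rw [topLevel_conj_level b hx hL hL']
  exact (hdom.reverse hpal).congr_right fun m hm => (netExp_conj_level b hL hL' h0 hm).symm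

omit hb hp5 hpal in
/-- **The parity of the degree**: `ε · (−1)^{deg P_x} = −(−1)^{E_x+1}` (`ε` the centre sign), since `deg P_x + [centre] = E_x + M`
and `M` is even. -/
theorem centreSign_mul_degSign :
    (if ¬ (2 : ℤ) ∣ b 0 ∧ CentreIn b p x then (-1 : ℚ) else 1) *
        (-1 : ℚ) ^ (shapePoly L a (topLevel b p x) e (fun k => netExp b (x + k * p))).natDegree =
      -(-1 : ℚ) ^ (classExp b p x + 1) := by
  have hxn : x ≤ (b 0).toNat := le_b0_of_lt b hpn hx
  obtain ⟨hL, hL'⟩ := level_bounds' (p := p) b hxn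
  have hdeg := shapePoly_natDegree_eq hdom.le hdom.dom (e := e) (f := fun k => netExp b (x + k * p))
  have hE := classExp_levelZ b hx hL hL'
  rw [hTM] at hdeg
  set d := (shapePoly L a (topLevel b p x) e (fun k => netExp b (x + k * p))).natDegree with hd
  obtain ⟨r, hr⟩ := hMe
  split_ifs with hc
  · rw [if_pos hc] at hE
    have hEd : classExp b p x = (d : ℤ) - M + 1 := by rw [hE]; omega
    rw [hEd, show ((d : ℤ) - M + 1 + 1) = (d : ℤ) + 2 * (1 - (r : ℤ)) by rw [hr]; push_cast; ring,
      zpow_add₀ (by norm_num : (-1 : ℚ) ≠ 0), zpow_natCast, zpow_mul, show ((-1 : ℚ) ^ (2 : ℤ)) = 1 by norm_num, one_zpow]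
    ring
  · rw [if_neg hc] at hE
    have hEd : classExp b p x = (d : ℤ) - M := by rw [hE]; omega
    rw [hEd, show ((d : ℤ) - M + 1) = (d : ℤ) + 1 + 2 * (-(r : ℤ)) by rw [hr]; push_cast; ring,
      zpow_add₀ (by norm_num : (-1 : ℚ) ≠ 0), zpow_mul, show ((-1 : ℚ) ^ (2 : ℤ)) = 1 by norm_num, one_zpow,
      show ((d : ℤ) + 1) = ((d + 1 : ℕ) : ℤ) by push_cast; ring, zpow_natCast, pow_succ]
    ring

omit hp5 in
/-- **THE POLYNOMIAL IDENTITY**: `H_x̄ + H_x(L − X) = (−p)^{E+M} · [Z_x̄(X+c)·P_x̄] · D_x(X + c)`. -/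
theorem classH_conj_add_reflect :
    classH b p (conjClass b p x) M L (topLevel b p x - L - a) e
        + (classH b p x M L a e).comp (Polynomial.C (L : ℚ) - Polynomial.X) =
      Polynomial.C ((-(p : ℚ)) ^ (classExp b p x + M)) *
        (((centreZ b p x (topLevel b p x)).comp (Polynomial.X + Polynomial.C (((topLevel b p x - L - a : ℕ) : ℚ))) *
          shapePoly L (topLevel b p x - L - a) (topLevel b p x) e (fun k => netExp b (x + (topLevel b p x - k) * p))) *
        (reflD b p x (topLevel b p x)).comp (Polynomial.X + Polynomial.C (((topLevel b p x - L - a : ℕ) : ℚ)))) := by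
  have h0 : 0 ≤ b 0 := hb.1.1
  have hxn : x ≤ (b 0).toNat := le_b0_of_lt b hpn hx
  obtain ⟨hL, hL'⟩ := level_bounds' (p := p) b hxn
  set L' := topLevel b p x with hL'def
  set c := L' - L - a with hcdef
  have hle : a + L ≤ L' := hdom.le
  have hsum : a + L + c = L' := by omega
  have hEc : classExp b p (conjClass b p x) = classExp b p x := classExp_conj b h0 hxn
  -- the pieces of `H_x̄`
  have hH1 : classH b p (conjClass b p x) M L c e =
      Polynomial.C ((-(p : ℚ)) ^ (classExp b p x + M) * gHat b p (conjClass b p x)) *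
        ((fourthQ b p (conjClass b p x) * centreZ b p x L').comp (Polynomial.X + Polynomial.C (c : ℚ)) *
          shapePoly L c L' e (fun k => netExp b (x + (L' - k) * p))) := by
    rw [classH, topLevel_conj_level b hx hL hL', hEc, centreZ_conj b hb hx hL hL', shapePoly_conj b hb hL hL']
  -- the reflected `H_x`
  have hP := shapePoly_reflect hle hpal (e := e) (f := fun k => netExp b (x + k * p))
  have hZ := centreZ_comp_reflect b (p := p) (x := x) (L := L) (a := a) (c := c) (L' := L') hsum
  have hsign := centreSign_mul_degSign b hpn hx hMe hTM hdom
  have hq : (Polynomial.X + Polynomial.C (a : ℚ)).comp (Polynomial.C (L : ℚ) - Polynomial.X) =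
      Polynomial.C ((L' : ℚ) - c) - Polynomial.X := by
    rw [Polynomial.add_comp, Polynomial.X_comp, Polynomial.C_comp,
      show ((L' : ℚ) - c) = (L : ℚ) + a by
        have : (L' : ℚ) = a + L + c := by exact_mod_cast hsum.symm
        rw [this]; ring, map_add]
    ring
  have hZ' : (centreZ b p x L').comp (Polynomial.C ((L' : ℚ) - c) - Polynomial.X) =
      Polynomial.C (if ¬ (2 : ℤ) ∣ b 0 ∧ CentreIn b p x then (-1 : ℚ) else 1) *
        (centreZ b p x L').comp (Polynomial.X + Polynomial.C (c : ℚ)) := by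
    rw [← hq, ← Polynomial.comp_assoc]; exact hZ
  have hH2 : (classH b p x M L a e).comp (Polynomial.C (L : ℚ) - Polynomial.X) =
      Polynomial.C ((-(p : ℚ)) ^ (classExp b p x + M) * gHat b p x) *
        ((fourthQ b p x).comp (Polynomial.C ((L' : ℚ) - c) - Polynomial.X) *
          (Polynomial.C (-(-1 : ℚ) ^ (classExp b p x + 1)) *
            ((centreZ b p x L').comp (Polynomial.X + Polynomial.C (c : ℚ)) *
              shapePoly L c L' e (fun k => netExp b (x + (L' - k) * p))))) := by
    rw [classH]
    simp only [Polynomial.mul_comp, Polynomial.C_comp, Polynomial.comp_assoc]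
    rw [hq, hZ', hP, ← hsign]
    simp only [map_mul]
    ring
  rw [hH1, hH2]
  -- `D_x(X + c)`
  have hD : (reflD b p x L').comp (Polynomial.X + Polynomial.C (c : ℚ)) =
      Polynomial.C (gHat b p (conjClass b p x)) * (fourthQ b p (conjClass b p x)).comp (Polynomial.X + Polynomial.C (c : ℚ))
        - Polynomial.C ((-1 : ℚ) ^ (classExp b p x + 1) * gHat b p x) *
          (fourthQ b p x).comp (Polynomial.C ((L' : ℚ) - c) - Polynomial.X) := by
    unfold reflD
    rw [Polynomial.sub_comp, Polynomial.mul_comp, Polynomial.C_comp, Polynomial.mul_comp, Polynomial.C_comp,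
      Polynomial.comp_assoc, Polynomial.sub_comp, Polynomial.C_comp, Polynomial.X_comp]
    congr 2
    rw [map_sub]; ring
  rw [hD]
  simp only [Polynomial.mul_comp, map_mul, map_neg]
  ring

/-- **REFLECTION OF THE CLASS POLYNOMIAL**: every coefficient of `H_x̄ + H_x(L − X)` has norm `≤ p⁻⁴` (`E_x + M ≥ 0`). -/
theorem classH_reflect (hpole : 1 ≤ classPoleCount b p x) (hEM : 0 ≤ classExp b p x + M) (n : ℕ) :
    padicNorm p ((classH b p (conjClass b p x) M L (topLevel b p x - L - a) e
        + (classH b p x M L a e).comp (Polynomial.C (L : ℚ) - Polynomial.X)).coeff n) ≤ (p : ℚ) ^ (-(4 : ℤ)) := by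
  have hp2 : p ≠ 2 := by omega
  have hxn : x ≤ (b 0).toNat := le_b0_of_lt b hpn hx
  obtain ⟨hL, hL'⟩ := level_bounds' (p := p) b hxn
  rw [classH_conj_add_reflect b hb hpn hx hMe hTM hdom hpal, ← Polynomial.coeff_coe, Polynomial.coe_mul,
    Polynomial.coe_mul, Polynomial.coe_mul, Polynomial.coe_C]
  set L' := topLevel b p x
  set c := L' - L - a
  -- the three factors
  have h1 : CoeffBound p 0 0 (C ((-(p : ℚ)) ^ (classExp b p x + M))) := by
    refine coeffBound_C ?_
    rw [LevelClass.padicNorm_neg_p_zpow, neg_zero]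
    exact zpow_le_one_of_nonpos₀ one_le_p (by linarith)
  have h2 : CoeffBound p 0 0 (((centreZ b p x L').comp (Polynomial.X + Polynomial.C (c : ℚ)) : Polynomial ℚ) : PowerSeries ℚ) := by
    unfold centreZ
    split_ifs
    · rw [Polynomial.sub_comp, Polynomial.X_comp, Polynomial.C_comp, add_sub_assoc, ← map_sub, Polynomial.coe_add,
        Polynomial.coe_X, Polynomial.coe_C]
      refine coeffBound_X_add_C le_rfl ?_
      rw [neg_zero, zpow_zero]
      exact (padicNorm.sub (p := p)).trans (max_le (by simpa using padicNorm.of_nat (p := p) c)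
        (by rw [padicNorm.div, padicNorm_two hp2, div_one]; simpa using padicNorm.of_nat (p := p) L'))
    · rw [Polynomial.one_comp, Polynomial.coe_one]; exact coeffBound_one
  have h3 : CoeffBound p 0 0 ((shapePoly L c L' e (fun k => netExp b (x + (L' - k) * p)) : Polynomial ℚ) : PowerSeries ℚ) :=
    fun k => by
      rw [Polynomial.coeff_coe]
      simpa using (padicNorm_shapePoly_coeff_le_one k :
        padicNorm p ((shapePoly L c L' e (fun k => netExp b (x + (L' - k) * p))).coeff k) ≤ 1)
  have h4 : CoeffBound p 0 4 (((reflD b p x L').comp (Polynomial.X + Polynomial.C (c : ℚ)) : Polynomial ℚ) : PowerSeries ℚ) :=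
    coeffBound_polyAtLevel (fun k => padicNorm_reflD_coeff_le b hb hp5 hpn hx hL hL' hpole k) c
  have h := (h1.mul ((h2.mul h3).mul h4)) n
  simp only [zero_mul, zero_add, add_zero, zero_sub] at h
  exact h

end Reflect

end Summit.KontsevichZagierPeriods.Zeta5Search.SecondOrder

end
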